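import Mathlib
import Summits.Parity.GeneralizedHardyLittlewood.Theses.LeeYangFibres

/-!
# Sketch — crux-ideate stmt-Parity-14109 (CellParityLaw), ideator 3, round 1 (rev 2: card slugs aligned)

First lemmas of the two idea cards, typed over existing declarations
(`Literature.NumberTheory.Sieve.*` from the Statement module, Mathlib's `Nat.minFac`,
`ArithmeticFunction.cardFactors`, `ArithmeticFunction.moebius`), plus the Walsh-inversion
transfer lemma. Helper `def`s below are abbreviations only (no new objects are posited).
Nothing here is proved; everything must elaborate.
-/

open scoped BigOperators Classical
open Literature.NumberTheory.Sieve Finset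

namespace Summit.Parity.GeneralizedHardyLittlewood.Cruxes.CellParityLaw.Sketch

/-- `m` (an integer value of a form) lies in the Ω-cell `c` at roughness `N^{1/u}`:
`P⁻(m) > N^{1/u}` and `Ω(m) = c` (exactly the inlined cell predicate of the route file). -/
def InCell (N u : ℕ) (m : ℤ) (c : ℕ) : Prop :=
  (N : ℝ) ^ ((1 : ℝ) / u) < (Nat.minFac m.toNat : ℝ) ∧ ArithmeticFunction.cardFactors m.toNat = c

/-- The joint cell count `C_j(Ψ, K, N, u)` of the route (all `t` forms in their cells). -/
noncomputable def cellCount {t : ℕ} (Ψ : Fin t → AffLinForm 1) (K : Set (Fin 1 → ℝ))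
    (N u : ℕ) (j : Fin t → ℕ) : ℕ :=
  ((latticeBox 1 N).filter (fun n => realPoint n ∈ K ∧ ∀ i, InCell N u ((Ψ i).eval n) (j i))).card

/-- The FIBRE of coordinate `i` in the class `c (mod d)`: lattice points `n ∈ K` with the OTHER
`t - 1` forms in their cells `j k` and `n ≡ c (mod d)` (no condition on `ψ_i`). This is the
Type-I datum `B_d` that coordinate-`i` Bombieri consumes (with `c` the zero class of `ψ_i`). -/
noncomputable def fibreCountAP {t : ℕ} (Ψ : Fin t → AffLinForm 1) (K : Set (Fin 1 → ℝ))
    (N u : ℕ) (i : Fin t) (j : Fin t → ℕ) (d : ℕ) (c : ℤ) : ℕ :=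
  ((latticeBox 1 N).filter (fun n => realPoint n ∈ K ∧
      (∀ k, k ≠ i → InCell N u ((Ψ k).eval n) (j k)) ∧ (d : ℤ) ∣ (n 0 - c))).card

/-- A class `c (mod d)` is FIBRE-GENERIC for coordinate `i`: no prime `p ∣ d` forces
`p ∣ ψ_k(n)` for some `k ≠ i` on the class. -/
def FibreGeneric {t : ℕ} (Ψ : Fin t → AffLinForm 1) (i : Fin t) (d : ℕ) (c : ℤ) : Prop :=
  ∀ p : ℕ, p.Prime → p ∣ d → ∀ k, k ≠ i → ¬ ((p : ℤ) ∣ (Ψ k).eval (fun _ => c))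

/-- Moduli admissible for the class-comparison statement: square-free, coprime to every linear
coefficient and to every pair "determinant" `a_i b_k - a_k b_i` (non-zero by non-degeneracy),
so that the zeros of distinct forms mod `p` are distinct and every form is invertible mod `p`. -/
def GoodModulus {t : ℕ} (Ψ : Fin t → AffLinForm 1) (d : ℕ) : Prop :=
  Squarefree d ∧ ∀ p : ℕ, p.Prime → p ∣ d →
    (∀ k, ¬ ((p : ℤ) ∣ (Ψ k).coeff 0)) ∧
    ∀ i k, i ≠ k → ¬ ((p : ℤ) ∣ ((Ψ i).coeff 0 * (Ψ k).const - (Ψ k).coeff 0 * (Ψ i).const))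

/-- **First lemma of card `one-level-per-epsilon` (FibreClassBV, level `θ`).**
Relative Bombieri–Vinogradov for the fibres, in main-term-free class-comparison form: on
average over good moduli `d ≤ N^θ`, any two fibre-generic classes of `n (mod d)` carry the same
number of fibre points up to a total error `N (log N)^{-A}`.
For `t = 2` and `θ < 1/2` this is PROVABLE NOW (the fibre is one shifted Ω-cell set = a
convolution of `≤ u` prime indicators: Vaughan/Motohashi + large sieve); for `t ≥ 3` the fibre
is an intersection of `≥ 2` shifted cell sets and even bounded moduli are open (see card). The
rung `θ` for every `θ < 1` is the line's open stub `FibreLevel`. -/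
def FibreClassBV (θ : ℝ) : Prop :=
  ∀ (t L u : ℕ) (A : ℝ), 1 ≤ t → 2 ≤ u → 0 < A → ∃ N₀ : ℕ, ∀ N : ℕ, N₀ ≤ N →
    ∀ Ψ : Fin t → AffLinForm 1, IsNondegenerateSystem Ψ → affLinSize Ψ N ≤ L →
    ∀ K : Set (Fin 1 → ℝ), Convex ℝ K → K ⊆ realBox 1 N →
    ∀ i : Fin t, ∀ j : Fin t → ℕ, (∀ k, 1 ≤ j k ∧ j k ≤ u) →
    ∀ c c' : ℕ → ℤ,
      (∀ d, GoodModulus Ψ d → FibreGeneric Ψ i d (c d) ∧ FibreGeneric Ψ i d (c' d)) →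
      ∑ d ∈ (Finset.Icc 1 ⌊(N : ℝ) ^ θ⌋₊).filter (fun d => GoodModulus Ψ d),
          |((fibreCountAP Ψ K N u i j d (c d) : ℕ) : ℝ) - (fibreCountAP Ψ K N u i j d (c' d) : ℕ)|
        ≤ (N : ℝ) / Real.log N ^ A

/-- The weight `b_i(m)` of the coordinate-`i` fibre SEQUENCE at the value `m`: the number of
lattice points `n ∈ K` with `ψ_i(n) = m` and the other forms in their cells. -/
noncomputable def fibreWeight {t : ℕ} (Ψ : Fin t → AffLinForm 1) (K : Set (Fin 1 → ℝ))
    (N u : ℕ) (i : Fin t) (j : Fin t → ℕ) (m : ℤ) : ℕ :=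
  ((latticeBox 1 N).filter (fun n => realPoint n ∈ K ∧
      (∀ k, k ≠ i → InCell N u ((Ψ k).eval n) (j k)) ∧ (Ψ i).eval n = m)).card

/-- **First lemma of card `composite-fibres-first` (the open atom, typed:
`DilatedFibreMoebius θ`).** Möbius is orthogonal to the DILATED fibre sequences
`m ↦ b_i(e·m)`, smoothly weighted in `log m / log N`, on average over dilations `e ~ E` for
every `E ∈ [N^δ, N^{1-θ}]` (so only `E ≤ N^{1/2}` matters once `θ ≥ 1/2`), with a log-power
saving. By the divisor switch `d ↔ m/d` (lemma `signedSwitch` below) this is EXACTLY the signed,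
zero-class, Möbius×smooth-weighted level-`θ` remainder bound that the finite-level cell-Bombieri
theorem consumes beyond the Bombieri–Vinogradov range. -/
def DilatedFibreMoebius (θ : ℝ) : Prop :=
  ∀ (t L u : ℕ) (A δ : ℝ), 1 ≤ t → 2 ≤ u → 0 < A → 0 < δ → ∃ N₀ : ℕ, ∀ N : ℕ, N₀ ≤ N →
    ∀ Ψ : Fin t → AffLinForm 1, IsNondegenerateSystem Ψ → affLinSize Ψ N ≤ L →
    ∀ K : Set (Fin 1 → ℝ), Convex ℝ K → K ⊆ realBox 1 N →
    ∀ i : Fin t, ∀ j : Fin t → ℕ, (∀ k, 1 ≤ j k ∧ j k ≤ u) →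
    ∀ G : ℝ → ℝ, LipschitzWith 1 G → (∀ x, |G x| ≤ 1) →
    ∀ E : ℕ, (N : ℝ) ^ δ ≤ E → (E : ℝ) ≤ (N : ℝ) ^ (1 - θ) →
      ∑ e ∈ (Finset.Ioc E (2 * E)).filter Squarefree,
          |∑ m ∈ Finset.Icc 1 ((L + 1) * N),
              (ArithmeticFunction.moebius m : ℝ) * G (Real.log m / Real.log N) *
                (fibreWeight Ψ K N u i j ((e : ℤ) * m) : ℕ)|
        ≤ (N : ℝ) / Real.log N ^ A

/-- **The divisor switch** (exact, elementary; first checkable identity of card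
`composite-fibres-first`): for square-free `m = d·e`, `μ(d) = μ(m) μ(e)`, so a
Möbius×`g`-weighted sum of the zero-class Type-I data over moduli `d ∈ (D, 2D]` equals a sum of
`μ(m) f(m)` against the short divisor sum `∑_{e ∣ m, m/e ∈ (D,2D]} μ(e) g(m/e)`. -/
def signedSwitch : Prop :=
  ∀ (N D : ℕ) (f g : ℕ → ℝ),
    ∑ d ∈ Finset.Ioc D (2 * D), (ArithmeticFunction.moebius d : ℝ) * g d *
        ∑ m ∈ (Finset.Icc 1 N).filter (fun m => d ∣ m ∧ Squarefree m), f m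
      = ∑ m ∈ (Finset.Icc 1 N).filter Squarefree,
          f m * (ArithmeticFunction.moebius m : ℝ) *
            ∑ e ∈ m.divisors.filter (fun e => m / e ∈ Finset.Ioc D (2 * D)),
              (ArithmeticFunction.moebius e : ℝ) * g (m / e)

/-- **Walsh inversion with positivity** (the θ-free TRANSFER shared by both cards; pure finite
algebra, provable now): non-negative class constants `κ_σ`, `σ ∈ {±}^t`, with mean `1` are
exactly the Walsh polynomials `∑_S θ_S ∏_{i∈S} σ_i` with `θ_∅ = 1` and `|θ_S| ≤ 1`. Hence
CellParityLaw ⟸ (parity-class proportionality with κ_σ ≥ 0) ∧ (balanced count: mean κ = 1),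
and the typed bound `|θ_S| ≤ 2` of the crux is automatic. -/
def walshInversionPositivity : Prop :=
  ∀ (t : ℕ) (κ : (Fin t → Bool) → ℝ), (∀ σ, 0 ≤ κ σ) → ∑ σ, κ σ = (2 : ℝ) ^ t →
    ∃ θ : Finset (Fin t) → ℝ, θ ∅ = 1 ∧ (∀ S, |θ S| ≤ 1) ∧
      ∀ σ, κ σ = ∑ S : Finset (Fin t), θ S * ∏ i ∈ S, (if σ i then (1 : ℝ) else -1)

/-- Sanity link to the crux (statement-level only): the route's decl is in scope. -/
example : Prop := Summit.Parity.GeneralizedHardyLittlewood.Theses.LeeYangFibres.CellParityLaw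

end Summit.Parity.GeneralizedHardyLittlewood.Cruxes.CellParityLaw.Sketch
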